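import Summits.QuantumFields.YangMills.Theorems.UnitScaleTiltFluctuationComparisonRegPrGlobalSlackLegNaturalLipCore
import Summits.QuantumFields.YangMills.Theorems.UnitScaleTiltFluctuationComparisonRegPrGlobalSlackLegCfgDistNaturalT3Gamma
import HarnessLib

/-!
# `UnitScaleTiltFluctuationComparisonRegPrGlobalSlackLegNaturalLipRows` — (Lip♮) FOR THE NATURAL CHART MAPS WITH A SELECTED ANCHOR IS A THEOREM: the `hLip` letter of
# `cfgDistCauchyΦ_naturalCoherent_of_newLevel_of_fine` VERBATIM at `dist := canonLegDist F`, `L_Φ := 256·L`, `δ :=` the bondwise sup distance, from the record's minimiser rows,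
# ym-inputs-p11's four window letters and ONE more window letter — WITHOUT the fine comparison (Fine_b) (crux `FluctuationComparisonRegPrIntL`, stmt-QuantumFields-20520, skeleton v5kD,
# STUB 3⁗χ(v4); cell `pub/ym-inputs`, seat ym-inputs-p12 gen 7 = INPUT-LIST I-11 row `CfgDistCauchyΦ`, LEAD ym-ust-20520-w2 g5's named row «(Lip♮)-KNIT», file 2 of 2; count-neutral helper,
# def-free, registry untouched)

WHY.  `…LegNaturalLipCore` (file 1, same seat) proves the record-free core: at two plaquette-regular fine fields of runs `K` and `K+1` the natural chart map is `256·L·(1 + d)·L^j`-Lipschitz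
in the bondwise sup distance, leg by leg, in print's regime — with no closeness assumption on the two fields.  THIS FILE instantiates it at the two fields the two-run row (BC) reads:
run `K`'s r1 minimiser `U_K = (q K).UkH (K−n) triv V↑` and run `K+1`'s `U′ = (q (K+1)).UkH (K+1−n) triv V↑` averaged once and read on run `K` — both inside print's plaquette clause
`PlaqSmall (regThreshold F n · (B₃θ_{b₀,p₁}(n)))` by r1 at the free window `θ_{b₀,p₁}(n)` (p11's ✓`plaqSmall_minimiser_of_rows_window`, letters `θ ≤ a₁`, `B₃θ ≤ a₀` at `K` and at `K+1`) —
at the anchor `sel K j Y ∈ anchors K j Y` of a listed block `Y = blockSet K (1+j) y′` (p11's ✓`l1_rel_le_mul_one_add_canonLegDist`: `|c₋ − y|₁ ≤ 3L(1 + canonLegDist)`), which is the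
`hLip` letter of ym-inputs-p12 g6's ✓`cfgDistCauchyΦ_naturalCoherent_of_newLevel_of_fine` binder for binder.  So LEAD ym-ust-20520-w2 g5's (B8) door loses (Lip♮): (B9) = (B8) with
`L_Φ := 256·L`, `δ := fun K k U U′ ↦ ⨆_e ‖U(e) − U′(e)‖`, `hLip := lipNaturalSel_rows …` and its threshold `γB` shrunk to `gammaθ b₀ p₁ σ_Lip`; what (BC) still displays is EXACTLY (New)
(B0's new-level coherence of `Bcfg`) and (Fine_b) (the two-cut-off consistency of the constrained minimisers in the bondwise sup distance, located-UNPRINTED for non-abelian `d = 3`).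

WHAT THIS FILE PROVES (def-free; every hypothesis inline).
* ★★ **`lipNaturalSel_of_minRows`** — (Lip♮) of ✓`cfgDistCauchyΦ_naturalCoherent_of_newLevel_of_fine` VERBATIM (`q`, `p₁`, `sel`; ANY datum `D` whose listed old domains are blocks; `dist :=
  canonLegDist F`, `L_Φ := 256·L`, `δ K k U U′ := ⨆_e ‖U(e) − U′(e)‖`) from `hsel`, `(q ·).minRows`, p11's window letters `hθ` (`θ ≤ a₁ ∧ B₃θ ≤ a₀ ∧ he3 ∧ he2`, every `n < K`, used at `K`
  and `K+1`) and `hθL : ∀ n, 8·10¹⁴·(B₃θ_{b₀,p₁}(n)) ≤ 1`;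
* ★★ **`lipNaturalSel_rows`** — the same at the rows datum `dataOfCoreRows q (canonPolymerRows q)` (= `dataOfV4chi p …` at `q := fun K ↦ (p K).toRows`, an `abbrev`);
* `windowLettersLip_of_le_gammaθ` (the five letters from ONE coupling threshold) and ★★ **`lipNaturalSel_rows_of_le_gammaθ`** — (Lip♮) at the rows datum with NO displayed letter below
  `γ ≤ gammaθ b₀ p₁ σ_Lip`, `σ_Lip = min a₁ (min (a₀/B₃) (min (1/(3·143·(7²/4)²·B₃)) (min (δ_{SU(2)}/((7L)²·B₃)) (1/(8·10¹⁴·B₃)))))`, at a coherent record (`(q K).a₀ = a₀`, `(q K).a₁ = a₁`).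
HONEST FRAMING.  Instantiation of file 1 at accepted record rows; no new estimate of the papers; (New), (Fine_b), (K)[Φ♮] untouched and NOT claimed.  Nothing of [Balaban1985UV3] /
[Balaban1985Averaging] / [Balaban1985Variational] / [Balaban1987RG1] / [King1986] is asserted; no stub / crux / registry object touched (`--supports stmt-QuantumFields-20520`); no summit /
rung / gap claim (YM₃ on T³ is ladder rung R3, not the Clay problem).  L-floor: none beyond `1 < L`.

References: T. Bałaban, CMP 98 (1985) 17–51 [Balaban1985Averaging] (Prop. 2 (52)–(54) p.26, Prop. 6 (164) p.43); CMP 102 (1985) 255–275 [Balaban1985UV3] ((7) p.257, (27)–(28) p.263,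
(43)–(44) pp.266–267); CMP 102 (1985) 277–309 [Balaban1985Variational] ((2) p.278, Thm 1 (8) p.279); CMP 109 (1987) 249–301 [Balaban1987RG1] ((0.1) p.251, (0.11) p.253); C. King, CMP 102
(1986) 649–677 [King1986] (Prop. 3.9 (3.73)–(3.74) p.665).
-/

set_option autoImplicit false

noncomputable section

open scoped Matrix.Norms.L2Operator
open Literature.MathematicalPhysics.QuantumFieldTheory.Balaban1983to89
open Literature.MathematicalPhysics.QuantumFieldTheory.Balaban1983to89.T3ContinuumYM3Torus
open Literature.MathematicalPhysics.QuantumFieldTheory.Balaban1983to89.T3UnitLawDensityEML (ℰp)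
open Literature.MathematicalPhysics.QuantumFieldTheory.Balaban1983to89.T3UnitScaleTilt (θBal)
open Literature.MathematicalPhysics.QuantumFieldTheory.Balaban1983to89.T3LevelShift
open Literature.MathematicalPhysics.QuantumFieldTheory.Balaban1983to89.T3RegularMinimiser (regThreshold)
open Literature.MathematicalPhysics.QuantumFieldTheory.Balaban1983to89.T3AlphaInputsAC (AlphaDataT3)
open Literature.MathematicalPhysics.QuantumFieldTheory.Balaban1983to89.T3AlphaPolymerSocket
open Literature.MathematicalPhysics.QuantumFieldTheory.Balaban1983to89.B10Eq27TorusAxialLog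
open Literature.MathematicalPhysics.QuantumFieldTheory.Balaban1983to89.B7Prop1Explicit (l1 Letter)
open Literature.MathematicalPhysics.QuantumFieldTheory.Balaban1983to89.ExpMeanLog (expMeanLogSU deltaSU deltaSU_pos)
open Literature.MathematicalPhysics.QuantumFieldTheory.Balaban1983to89.BlockAveragingEMLProp2 (plaqSmall_iter_blockAvg_eml_level)
open Literature.MathematicalPhysics.QuantumFieldTheory.Balaban1985CMP102
open Literature.MathematicalPhysics.QuantumFieldTheory.Balaban1985CMP102.Setting
open Summit.QuantumFields.Balaban3D.Carriers
open Summit.QuantumFields.Balaban3D.Proofs.Primitives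
open Summit.QuantumFields.Balaban3D.Proofs.GroupModelLieC (vecE lieC)
open Summit.QuantumFields.YangMills.Theorems
open Summit.QuantumFields.YangMills.Theorems.GlobalSlackKernelMatching
open Summit.QuantumFields.YangMills.Theorems.GlobalSlackCanonicalPolymers

namespace Summit.QuantumFields.YangMills.Theorems.GlobalSlackKernelLeg

variable {F : T3Family}

/-! ## (Lip♮) of `cfgDistCauchyΦ_naturalCoherent_of_newLevel_of_fine`, verbatim, for the natural family of a rows record with a selected anchor -/

section Natural

variable {𝔠 : AlphaConsts F.L (suGroupModel 2).N} {γ : ℝ} {hγ : 0 < γ} {hγ1 : γ ≤ (min 𝔠.gamma0 1) ^ 2}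

/-- ★★ **(Lip♮) FOR THE NATURAL CHART MAPS WITH A SELECTED ANCHOR IS A THEOREM** — the `hLip` letter of ✓`cfgDistCauchyΦ_naturalCoherent_of_newLevel_of_fine` VERBATIM at
`dist := canonLegDist F`, `L_Φ := 256·L`, `δ K k U U′ := ⨆_e ‖U(e) − U′(e)‖` (bondwise sup on run `K`'s finest lattice), for every rows record `q`, profile `p₁`, anchor selector `sel` with
`sel K b Y ∈ anchors K b Y`, and ANY datum `D` whose listed domains below the new level are single blocks (`hD`).  Displayed letters: ym-inputs-p11's four window letters `hθ` (r1's
range `θ ≤ a₁`, `B₃θ ≤ a₀` at the record's own `(q K).a₀`, `(q K).a₁`, and [B7] Prop. 2's two smallness letters), used at runs `K` and `K+1`, and ONE more: `hθL : 8·10¹⁴·B₃θ_{b₀,p₁}(n) ≤ 1`.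
NOT displayed: (Fine_b) — the two fine fields need not be close; where they are not, print's (44) bounds both loop variables below the Lipschitz bound (§2).  The two fields are
run `K`'s r1 minimiser `(q K).UkH (K−n) triv V↑` and run `K+1`'s `(q (K+1)).UkH (K+1−n) triv V↑` averaged once and read on run `K`'s finest lattice, both plaquette-regular by
`plaqSmall_minimiser_of_rows_window`. [cite: Balaban1985Averaging, Prop. 2 (54) p.26, Prop. 6 (164) p.43; Balaban1985UV3, (27)-(28) p.263, (43)-(44) pp.266-267; Balaban1985Variational, Thm 1 (8) p.279; Balaban1987RG1, (0.1) p.251, (0.11) p.253] -/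
theorem lipNaturalSel_of_minRows (q : ∀ K, AlphaInputsT3AC.PkgCoreRows F 𝔠 γ hγ hγ1 K) (p₁ : ℝ)
    (sel : (K b : ℕ) → Set (Site (F.P K) 0) → Site (F.P K) b)
    (hsel : ∀ (K b : ℕ) (Y : Set (Site (F.P K) 0)), sel K b Y ∈ anchors K b Y)
    (D : AlphaDataT3 F γ)
    (hD : ∀ (K k i : ℕ), k ≤ K → i < k → 1 ≤ i → ∀ Y ∈ D.Loc K k (D.triv K k) i, ∃ y : Site (F.P K) i, Y = blockSet K i y)
    (hθ : ∀ K n, n < K →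
      θBal F.L γ 𝔠.b₀ p₁ n ≤ (q K).a₁ ∧ 𝔠.B₃ * θBal F.L γ 𝔠.b₀ p₁ n ≤ (q K).a₀ ∧
      (143 * ((((3 + 4 : ℕ) : ℝ)) ^ 2 / 4) ^ 2) * (𝔠.B₃ * θBal F.L γ 𝔠.b₀ p₁ n) ≤ 1 / 3 ∧
      2 * (𝔠.B₃ * θBal F.L γ 𝔠.b₀ p₁ n) ≤ 2 * deltaSU (Fin 2) / (((3 + 4) * F.L : ℕ) : ℝ) ^ 2)
    (hθL : ∀ n, 8 * 10 ^ 14 * (𝔠.B₃ * θBal F.L γ 𝔠.b₀ p₁ n) ≤ 1) :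
    ∀ (K n : ℕ) (h : n ≤ K), ∀ j : ℕ, j + 1 < K - n → ∀ V : GaugeField (F.P n) 0 (Matrix.specialUnitaryGroup (Fin 2) ℂ), PlaqSmall (θBal F.L γ 𝔠.b₀ p₁ n) V →
        ∀ Y ∈ D.Loc K (K - n) (D.triv K (K - n)) (1 + j), ∀ c : PBond (F.P K) j,
          ‖(fun K k b Y (U : GaugeField (F.P K) 0 (Matrix.specialUnitaryGroup (Fin 2) ℂ)) c =>
        if (l1 (rel (sel K b Y) c.src) : ℝ) * (2 * (𝔠.B₃ * θBal F.L γ 𝔠.b₀ p₁ (K - k)) * (((F.L : ℝ) ^ (k - b))⁻¹) ^ 2) ≤ 1 / 2 then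
          (lieC (suGroupModel 2)).orthogonalProjectionOnto (vecE (suGroupModel 2).N (B27T (unitsField (toUField
            (Averaging.iter (fun i => BlockAveraging.blockAvg (P := F.P K) (j := i) ℰp) b U))) (sel K b Y) c))
        else 0) K (K - n) j Y ((q K).UkH (K - n) (Hist.triv (F.P K) (K - n)) (fieldShift (F.sitesPerDir_eq (m := F.m) (K := K) (j := K - n) (m' := F.m) (K' := n) (j' := 0) (by omega)) V)) c -
            (fun K k b Y (U : GaugeField (F.P K) 0 (Matrix.specialUnitaryGroup (Fin 2) ℂ)) c =>
        if (l1 (rel (sel K b Y) c.src) : ℝ) * (2 * (𝔠.B₃ * θBal F.L γ 𝔠.b₀ p₁ (K - k)) * (((F.L : ℝ) ^ (k - b))⁻¹) ^ 2) ≤ 1 / 2 then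
          (lieC (suGroupModel 2)).orthogonalProjectionOnto (vecE (suGroupModel 2).N (B27T (unitsField (toUField
            (Averaging.iter (fun i => BlockAveraging.blockAvg (P := F.P K) (j := i) ℰp) b U))) (sel K b Y) c))
        else 0) K (K - n) j Y
              (fieldShift (F.sitesPerDir_eq (m := F.m) (K := K) (j := 0) (m' := F.m) (K' := K + 1) (j' := 1) (by omega)) ((BlockAveraging.blockAvg (P := F.P (K + 1)) (j := 0) ℰp).avg
                ((q (K + 1)).UkH (K + 1 - n) (Hist.triv (F.P (K + 1)) (K + 1 - n)) (fieldShift (F.sitesPerDir_eq (m := F.m) (K := K + 1) (j := K + 1 - n) (m' := F.m) (K' := n) (j' := 0) (by omega)) V)))) c‖ ≤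
            256 * (F.L : ℝ) * (1 + canonLegDist F K j Y c) * (F.L : ℝ) ^ j *
              ⨆ e' : PBond (F.P K) 0, ‖(((q K).UkH (K - n) (Hist.triv (F.P K) (K - n)) (fieldShift (F.sitesPerDir_eq (m := F.m) (K := K) (j := K - n) (m' := F.m) (K' := n) (j' := 0) (by omega)) V) e' : Matrix.specialUnitaryGroup (Fin 2) ℂ) : Matrix (Fin 2) (Fin 2) ℂ) -
                ((fieldShift (F.sitesPerDir_eq (m := F.m) (K := K) (j := 0) (m' := F.m) (K' := K + 1) (j' := 1) (by omega)) ((BlockAveraging.blockAvg (P := F.P (K + 1)) (j := 0) ℰp).avg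
                ((q (K + 1)).UkH (K + 1 - n) (Hist.triv (F.P (K + 1)) (K + 1 - n)) (fieldShift (F.sitesPerDir_eq (m := F.m) (K := K + 1) (j := K + 1 - n) (m' := F.m) (K' := n) (j' := 0) (by omega)) V))) e' : Matrix.specialUnitaryGroup (Fin 2) ℂ) : Matrix (Fin 2) (Fin 2) ℂ)‖ := by
  intro K n hnK j hj V hV Y hY c
  have hn : n < K := by omega
  have hKn : K - (K - n) = n := by omega
  obtain ⟨y', rfl⟩ := hD K (K - n) (1 + j) (by omega) (by omega) (by omega) Y hY
  obtain ⟨h1, h2, h3, h4⟩ := hθ K n hn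
  obtain ⟨h1', h2', -, -⟩ := hθ (K + 1) n (by omega)
  have hγ1' : γ ≤ 1 := hγ1.trans (sq_min_one_le _ 𝔠.gamma0_pos)
  have hθpos : 0 < θBal F.L γ 𝔠.b₀ p₁ n := T3MinimiserStabilityReduction.θBal_pos F.hL.2.le hγ hγ1' 𝔠.b₀_pos p₁ n
  have he : 0 < 𝔠.B₃ * θBal F.L γ 𝔠.b₀ p₁ n := mul_pos 𝔠.B₃_pos hθpos
  have hA := plaqSmall_minimiser_of_rows_window (q K).minRows hn hθpos h1 h2 V hV
  have hU' := plaqSmall_minimiser_of_rows_window (q (K + 1)).minRows (show n < K + 1 by omega) hθpos h1' h2' V hV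
  have hd : 0 ≤ canonLegDist F K j (blockSet K (1 + j) y') c := canonLegDist_nonneg F K j _ c
  dsimp only
  rw [hKn]
  split_ifs with hreg
  · exact norm_naturalMap_sub_le_of_regular hnK hj he h3 h4 (hθL n) _ _ hA hU' (sel K j (blockSet K (1 + j) y')) c hd
      (l1_rel_le_mul_one_add_canonLegDist (show 1 + j = j + 1 by omega) (show 1 + j ≤ F.m + K by omega) y' (hsel K j (blockSet K (1 + j) y')) c) hreg
  · rw [sub_zero, norm_zero]
    exact mul_nonneg (by positivity) (Real.iSup_nonneg fun _ => norm_nonneg _)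

/-- ★★ **(Lip♮) AT THE ROWS DATUM** `dataOfCoreRows q (canonPolymerRows q)` — whose listed domains below the new level ARE single blocks (`exists_blockSet_of_mem_canonLocRows`); the v4
χ-package instance is `q := fun K ↦ (p K).toRows` (datum `dataOfV4chi p (canonPolymerRows fun K ↦ (p K).toRows)`, an `abbrev`), i.e. (B8)'s `hLip` slot at `dist := canonLegDist F`,
`L_Φ := 256·L`, `δ :=` the bondwise sup. [cite: Balaban1985Averaging, Prop. 6 (164) p.43; Balaban1985UV3, (27)-(28) p.263, (43)-(44) pp.266-267; Balaban1987RG1, (0.1) p.251, (0.11) p.253] -/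
theorem lipNaturalSel_rows (q : ∀ K, AlphaInputsT3AC.PkgCoreRows F 𝔠 γ hγ hγ1 K) (p₁ : ℝ)
    (sel : (K b : ℕ) → Set (Site (F.P K) 0) → Site (F.P K) b)
    (hsel : ∀ (K b : ℕ) (Y : Set (Site (F.P K) 0)), sel K b Y ∈ anchors K b Y)
    (hθ : ∀ K n, n < K →
      θBal F.L γ 𝔠.b₀ p₁ n ≤ (q K).a₁ ∧ 𝔠.B₃ * θBal F.L γ 𝔠.b₀ p₁ n ≤ (q K).a₀ ∧
      (143 * ((((3 + 4 : ℕ) : ℝ)) ^ 2 / 4) ^ 2) * (𝔠.B₃ * θBal F.L γ 𝔠.b₀ p₁ n) ≤ 1 / 3 ∧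
      2 * (𝔠.B₃ * θBal F.L γ 𝔠.b₀ p₁ n) ≤ 2 * deltaSU (Fin 2) / (((3 + 4) * F.L : ℕ) : ℝ) ^ 2)
    (hθL : ∀ n, 8 * 10 ^ 14 * (𝔠.B₃ * θBal F.L γ 𝔠.b₀ p₁ n) ≤ 1) :
    ∀ (K n : ℕ) (h : n ≤ K), ∀ j : ℕ, j + 1 < K - n → ∀ V : GaugeField (F.P n) 0 (Matrix.specialUnitaryGroup (Fin 2) ℂ), PlaqSmall (θBal F.L γ 𝔠.b₀ p₁ n) V →
        ∀ Y ∈ (AlphaInputsT3AC.dataOfCoreRows q (canonPolymerRows q)).Loc K (K - n) ((AlphaInputsT3AC.dataOfCoreRows q (canonPolymerRows q)).triv K (K - n)) (1 + j), ∀ c : PBond (F.P K) j,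
          ‖(fun K k b Y (U : GaugeField (F.P K) 0 (Matrix.specialUnitaryGroup (Fin 2) ℂ)) c =>
        if (l1 (rel (sel K b Y) c.src) : ℝ) * (2 * (𝔠.B₃ * θBal F.L γ 𝔠.b₀ p₁ (K - k)) * (((F.L : ℝ) ^ (k - b))⁻¹) ^ 2) ≤ 1 / 2 then
          (lieC (suGroupModel 2)).orthogonalProjectionOnto (vecE (suGroupModel 2).N (B27T (unitsField (toUField
            (Averaging.iter (fun i => BlockAveraging.blockAvg (P := F.P K) (j := i) ℰp) b U))) (sel K b Y) c))
        else 0) K (K - n) j Y ((q K).UkH (K - n) (Hist.triv (F.P K) (K - n)) (fieldShift (F.sitesPerDir_eq (m := F.m) (K := K) (j := K - n) (m' := F.m) (K' := n) (j' := 0) (by omega)) V)) c -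
            (fun K k b Y (U : GaugeField (F.P K) 0 (Matrix.specialUnitaryGroup (Fin 2) ℂ)) c =>
        if (l1 (rel (sel K b Y) c.src) : ℝ) * (2 * (𝔠.B₃ * θBal F.L γ 𝔠.b₀ p₁ (K - k)) * (((F.L : ℝ) ^ (k - b))⁻¹) ^ 2) ≤ 1 / 2 then
          (lieC (suGroupModel 2)).orthogonalProjectionOnto (vecE (suGroupModel 2).N (B27T (unitsField (toUField
            (Averaging.iter (fun i => BlockAveraging.blockAvg (P := F.P K) (j := i) ℰp) b U))) (sel K b Y) c))
        else 0) K (K - n) j Y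
              (fieldShift (F.sitesPerDir_eq (m := F.m) (K := K) (j := 0) (m' := F.m) (K' := K + 1) (j' := 1) (by omega)) ((BlockAveraging.blockAvg (P := F.P (K + 1)) (j := 0) ℰp).avg
                ((q (K + 1)).UkH (K + 1 - n) (Hist.triv (F.P (K + 1)) (K + 1 - n)) (fieldShift (F.sitesPerDir_eq (m := F.m) (K := K + 1) (j := K + 1 - n) (m' := F.m) (K' := n) (j' := 0) (by omega)) V)))) c‖ ≤
            256 * (F.L : ℝ) * (1 + canonLegDist F K j Y c) * (F.L : ℝ) ^ j *
              ⨆ e' : PBond (F.P K) 0, ‖(((q K).UkH (K - n) (Hist.triv (F.P K) (K - n)) (fieldShift (F.sitesPerDir_eq (m := F.m) (K := K) (j := K - n) (m' := F.m) (K' := n) (j' := 0) (by omega)) V) e' : Matrix.specialUnitaryGroup (Fin 2) ℂ) : Matrix (Fin 2) (Fin 2) ℂ) -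
                ((fieldShift (F.sitesPerDir_eq (m := F.m) (K := K) (j := 0) (m' := F.m) (K' := K + 1) (j' := 1) (by omega)) ((BlockAveraging.blockAvg (P := F.P (K + 1)) (j := 0) ℰp).avg
                ((q (K + 1)).UkH (K + 1 - n) (Hist.triv (F.P (K + 1)) (K + 1 - n)) (fieldShift (F.sitesPerDir_eq (m := F.m) (K := K + 1) (j := K + 1 - n) (m' := F.m) (K' := n) (j' := 0) (by omega)) V))) e' : Matrix.specialUnitaryGroup (Fin 2) ℂ) : Matrix (Fin 2) (Fin 2) ℂ)‖ :=
  lipNaturalSel_of_minRows q p₁ sel hsel (AlphaInputsT3AC.dataOfCoreRows q (canonPolymerRows q))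
    (fun _ _ _ hk hik hi1 _ hY => exists_blockSet_of_mem_canonLocRows q hk hik hi1 hY) hθ hθL

/-- **THE FIVE WINDOW LETTERS FROM ONE COUPLING THRESHOLD**: for `0 < a₀, a₁, p₁` and `γ ≤ gammaθ b₀ p₁ σ_Lip`,
`σ_Lip = min a₁ (min (a₀/B₃) (min (1/(3·143·(7²/4)²·B₃)) (min (δ_{SU(2)}/((7L)²·B₃)) (1/(8·10¹⁴·B₃)))))`, every height `n` has `θ_{b₀,p₁}(n) ≤ a₁`, `B₃θ ≤ a₀`, `143(7²/4)²·B₃θ ≤ ⅓`,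
`2B₃θ ≤ 2δ_{SU(2)}/(7L)²` and `8·10¹⁴·B₃θ ≤ 1` (`T3Thresholds.θBal_le_of_le_gamma`). [cite: Balaban1985UV3, (7) p.257, p.267 L1-3] -/
theorem windowLettersLip_of_le_gammaθ {a₀ a₁ p₁ : ℝ} (hγ0 : 0 < γ) (hγle : γ ≤ 1) (ha₀ : 0 < a₀) (ha₁ : 0 < a₁) (hp₁ : 0 < p₁)
    (hγw : γ ≤ gammaθ 𝔠.b₀ p₁ (min a₁ (min (a₀ / 𝔠.B₃) (min (1 / (3 * (143 * ((((3 + 4 : ℕ) : ℝ)) ^ 2 / 4) ^ 2) * 𝔠.B₃))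
      (min (deltaSU (Fin 2) / ((((3 + 4) * F.L : ℕ) : ℝ) ^ 2 * 𝔠.B₃)) (1 / (8 * 10 ^ 14 * 𝔠.B₃))))))) (n : ℕ) :
    θBal F.L γ 𝔠.b₀ p₁ n ≤ a₁ ∧ 𝔠.B₃ * θBal F.L γ 𝔠.b₀ p₁ n ≤ a₀ ∧
      (143 * ((((3 + 4 : ℕ) : ℝ)) ^ 2 / 4) ^ 2) * (𝔠.B₃ * θBal F.L γ 𝔠.b₀ p₁ n) ≤ 1 / 3 ∧
      2 * (𝔠.B₃ * θBal F.L γ 𝔠.b₀ p₁ n) ≤ 2 * deltaSU (Fin 2) / (((3 + 4) * F.L : ℕ) : ℝ) ^ 2 ∧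
      8 * 10 ^ 14 * (𝔠.B₃ * θBal F.L γ 𝔠.b₀ p₁ n) ≤ 1 := by
  have hL : 1 ≤ F.L := F.hL.2.le
  have hB : 0 < 𝔠.B₃ := 𝔠.B₃_pos
  have hδ : 0 < deltaSU (Fin 2) := deltaSU_pos
  have hC : (0 : ℝ) < 143 * ((((3 + 4 : ℕ) : ℝ)) ^ 2 / 4) ^ 2 := by positivity
  have hL7 : (0 : ℝ) < (((3 + 4) * F.L : ℕ) : ℝ) ^ 2 := by have := F.hL.2; positivity
  set σ := min a₁ (min (a₀ / 𝔠.B₃) (min (1 / (3 * (143 * ((((3 + 4 : ℕ) : ℝ)) ^ 2 / 4) ^ 2) * 𝔠.B₃))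
      (min (deltaSU (Fin 2) / ((((3 + 4) * F.L : ℕ) : ℝ) ^ 2 * 𝔠.B₃)) (1 / (8 * 10 ^ 14 * 𝔠.B₃))))) with hσ
  have hσ0 : 0 ≤ σ := by rw [hσ]; positivity
  have hθ := T3Thresholds.θBal_le_of_le_gamma hL 𝔠.b₀_pos hp₁ hσ0 hγ0 hγle hγw n
  set θ := θBal F.L γ 𝔠.b₀ p₁ n with hθdef
  have h1 : θ ≤ a₁ := hθ.trans (min_le_left _ _)
  have h2 : θ ≤ a₀ / 𝔠.B₃ := hθ.trans ((min_le_right _ _).trans (min_le_left _ _))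
  have h3 : θ ≤ 1 / (3 * (143 * ((((3 + 4 : ℕ) : ℝ)) ^ 2 / 4) ^ 2) * 𝔠.B₃) :=
    hθ.trans ((min_le_right _ _).trans ((min_le_right _ _).trans (min_le_left _ _)))
  have h4 : θ ≤ deltaSU (Fin 2) / ((((3 + 4) * F.L : ℕ) : ℝ) ^ 2 * 𝔠.B₃) :=
    hθ.trans ((min_le_right _ _).trans ((min_le_right _ _).trans ((min_le_right _ _).trans (min_le_left _ _))))
  have h5 : θ ≤ 1 / (8 * 10 ^ 14 * 𝔠.B₃) :=
    hθ.trans ((min_le_right _ _).trans ((min_le_right _ _).trans ((min_le_right _ _).trans (min_le_right _ _))))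
  refine ⟨h1, ?_, ?_, ?_, ?_⟩
  · calc 𝔠.B₃ * θ ≤ 𝔠.B₃ * (a₀ / 𝔠.B₃) := mul_le_mul_of_nonneg_left h2 hB.le
      _ = a₀ := by field_simp
  · calc (143 * ((((3 + 4 : ℕ) : ℝ)) ^ 2 / 4) ^ 2) * (𝔠.B₃ * θ)
        ≤ (143 * ((((3 + 4 : ℕ) : ℝ)) ^ 2 / 4) ^ 2) * (𝔠.B₃ * (1 / (3 * (143 * ((((3 + 4 : ℕ) : ℝ)) ^ 2 / 4) ^ 2) * 𝔠.B₃))) := by gcongr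
      _ = 1 / 3 := by field_simp
  · calc 2 * (𝔠.B₃ * θ) ≤ 2 * (𝔠.B₃ * (deltaSU (Fin 2) / ((((3 + 4) * F.L : ℕ) : ℝ) ^ 2 * 𝔠.B₃))) := by gcongr
      _ = 2 * deltaSU (Fin 2) / (((3 + 4) * F.L : ℕ) : ℝ) ^ 2 := by field_simp
  · calc 8 * 10 ^ 14 * (𝔠.B₃ * θ) ≤ 8 * 10 ^ 14 * (𝔠.B₃ * (1 / (8 * 10 ^ 14 * 𝔠.B₃))) := by gcongr
      _ = 1 := by field_simp

/-- ★★ **(Lip♮) AT THE ROWS DATUM BELOW ONE EXPLICIT COUPLING THRESHOLD**: at a coherent record (`(q K).a₀ = a₀`, `(q K).a₁ = a₁`), for every profile `p₁ > 0` and every coupling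
`γ ≤ gammaθ b₀ p₁ σ_Lip` (`windowLettersLip_of_le_gammaθ`), the `hLip` letter of ✓`cfgDistCauchyΦ_naturalCoherent_of_newLevel_of_fine` at `dist := canonLegDist F`, `L_Φ := 256·L`, `δ :=` the
bondwise sup holds with NO displayed letter. [cite: Balaban1985Averaging, Prop. 6 (164) p.43; Balaban1985UV3, (7) p.257, (27)-(28) p.263, (43)-(44) pp.266-267; Balaban1987RG1, (0.1) p.251, (0.11) p.253] -/
theorem lipNaturalSel_rows_of_le_gammaθ (q : ∀ K, AlphaInputsT3AC.PkgCoreRows F 𝔠 γ hγ hγ1 K) {a₀ a₁ p₁ : ℝ} (ha₀ : 0 < a₀) (ha₁ : 0 < a₁)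
    (hp : ∀ K, (q K).a₀ = a₀ ∧ (q K).a₁ = a₁) (hp₁ : 0 < p₁)
    (sel : (K b : ℕ) → Set (Site (F.P K) 0) → Site (F.P K) b)
    (hsel : ∀ (K b : ℕ) (Y : Set (Site (F.P K) 0)), sel K b Y ∈ anchors K b Y)
    (hγw : γ ≤ gammaθ 𝔠.b₀ p₁ (min a₁ (min (a₀ / 𝔠.B₃) (min (1 / (3 * (143 * ((((3 + 4 : ℕ) : ℝ)) ^ 2 / 4) ^ 2) * 𝔠.B₃))
      (min (deltaSU (Fin 2) / ((((3 + 4) * F.L : ℕ) : ℝ) ^ 2 * 𝔠.B₃)) (1 / (8 * 10 ^ 14 * 𝔠.B₃))))))) :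
    ∀ (K n : ℕ) (h : n ≤ K), ∀ j : ℕ, j + 1 < K - n → ∀ V : GaugeField (F.P n) 0 (Matrix.specialUnitaryGroup (Fin 2) ℂ), PlaqSmall (θBal F.L γ 𝔠.b₀ p₁ n) V →
        ∀ Y ∈ (AlphaInputsT3AC.dataOfCoreRows q (canonPolymerRows q)).Loc K (K - n) ((AlphaInputsT3AC.dataOfCoreRows q (canonPolymerRows q)).triv K (K - n)) (1 + j), ∀ c : PBond (F.P K) j,
          ‖(fun K k b Y (U : GaugeField (F.P K) 0 (Matrix.specialUnitaryGroup (Fin 2) ℂ)) c =>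
        if (l1 (rel (sel K b Y) c.src) : ℝ) * (2 * (𝔠.B₃ * θBal F.L γ 𝔠.b₀ p₁ (K - k)) * (((F.L : ℝ) ^ (k - b))⁻¹) ^ 2) ≤ 1 / 2 then
          (lieC (suGroupModel 2)).orthogonalProjectionOnto (vecE (suGroupModel 2).N (B27T (unitsField (toUField
            (Averaging.iter (fun i => BlockAveraging.blockAvg (P := F.P K) (j := i) ℰp) b U))) (sel K b Y) c))
        else 0) K (K - n) j Y ((q K).UkH (K - n) (Hist.triv (F.P K) (K - n)) (fieldShift (F.sitesPerDir_eq (m := F.m) (K := K) (j := K - n) (m' := F.m) (K' := n) (j' := 0) (by omega)) V)) c -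
            (fun K k b Y (U : GaugeField (F.P K) 0 (Matrix.specialUnitaryGroup (Fin 2) ℂ)) c =>
        if (l1 (rel (sel K b Y) c.src) : ℝ) * (2 * (𝔠.B₃ * θBal F.L γ 𝔠.b₀ p₁ (K - k)) * (((F.L : ℝ) ^ (k - b))⁻¹) ^ 2) ≤ 1 / 2 then
          (lieC (suGroupModel 2)).orthogonalProjectionOnto (vecE (suGroupModel 2).N (B27T (unitsField (toUField
            (Averaging.iter (fun i => BlockAveraging.blockAvg (P := F.P K) (j := i) ℰp) b U))) (sel K b Y) c))
        else 0) K (K - n) j Y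
              (fieldShift (F.sitesPerDir_eq (m := F.m) (K := K) (j := 0) (m' := F.m) (K' := K + 1) (j' := 1) (by omega)) ((BlockAveraging.blockAvg (P := F.P (K + 1)) (j := 0) ℰp).avg
                ((q (K + 1)).UkH (K + 1 - n) (Hist.triv (F.P (K + 1)) (K + 1 - n)) (fieldShift (F.sitesPerDir_eq (m := F.m) (K := K + 1) (j := K + 1 - n) (m' := F.m) (K' := n) (j' := 0) (by omega)) V)))) c‖ ≤
            256 * (F.L : ℝ) * (1 + canonLegDist F K j Y c) * (F.L : ℝ) ^ j *
              ⨆ e' : PBond (F.P K) 0, ‖(((q K).UkH (K - n) (Hist.triv (F.P K) (K - n)) (fieldShift (F.sitesPerDir_eq (m := F.m) (K := K) (j := K - n) (m' := F.m) (K' := n) (j' := 0) (by omega)) V) e' : Matrix.specialUnitaryGroup (Fin 2) ℂ) : Matrix (Fin 2) (Fin 2) ℂ) -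
                ((fieldShift (F.sitesPerDir_eq (m := F.m) (K := K) (j := 0) (m' := F.m) (K' := K + 1) (j' := 1) (by omega)) ((BlockAveraging.blockAvg (P := F.P (K + 1)) (j := 0) ℰp).avg
                ((q (K + 1)).UkH (K + 1 - n) (Hist.triv (F.P (K + 1)) (K + 1 - n)) (fieldShift (F.sitesPerDir_eq (m := F.m) (K := K + 1) (j := K + 1 - n) (m' := F.m) (K' := n) (j' := 0) (by omega)) V))) e' : Matrix.specialUnitaryGroup (Fin 2) ℂ) : Matrix (Fin 2) (Fin 2) ℂ)‖ := by
  have hγ1' : γ ≤ 1 := hγ1.trans (sq_min_one_le _ 𝔠.gamma0_pos)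
  refine lipNaturalSel_rows q p₁ sel hsel (fun K n _ => ?_) fun n => (windowLettersLip_of_le_gammaθ (𝔠 := 𝔠) hγ hγ1' ha₀ ha₁ hp₁ hγw n).2.2.2.2
  obtain ⟨e1, e2, e3, e4, -⟩ := windowLettersLip_of_le_gammaθ (𝔠 := 𝔠) hγ hγ1' ha₀ ha₁ hp₁ hγw n
  rw [(hp K).1, (hp K).2]
  exact ⟨e1, e2, e3, e4⟩

/-! ## (Lip♮) in (B8)'s own letters: the v4 χ-package -/

/-- ★★ **(Lip♮) IN THE LETTERS OF LEAD's (B8) DOOR** (`…NaturalRowsTwoRunDoorSelCoherent`): the v4 χ-package `p : ∀ K, PkgAtV4Chi …` at a coherent `(a₀, a₁)`, datum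
`dataOfV4chi p (canonPolymerRows fun K ↦ (p K).toRows)`, fields `(p K).UkH`, anchor selector `sel` with `hsel`, profile `p₁ > 0`, below `γ ≤ gammaθ b₀ p₁ σ_Lip` — the (Lip♮) conjunct of
(B8)'s hypothesis with `L_Φ := 256·L` and `δ K k U U′ := ⨆_e ‖U(e) − U′(e)‖`, NO other letter (`lipNaturalSel_rows_of_le_gammaθ` at `q := fun K ↦ (p K).toRows`, by `rfl` on the record's
projections). [cite: Balaban1985Averaging, Prop. 6 (164) p.43; Balaban1985UV3, (7) p.257, (27)-(28) p.263, (43)-(44) pp.266-267; Balaban1987RG1, (0.1) p.251, (0.11) p.253] -/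
theorem lipNaturalSel_chiV4_of_le_gammaθ (p : ∀ K, AlphaInputsT3AC.PkgAtV4Chi F 𝔠 γ hγ hγ1 K) {a₀ a₁ p₁ : ℝ} (ha₀ : 0 < a₀) (ha₁ : 0 < a₁)
    (hp : ∀ K, (p K).a₀ = a₀ ∧ (p K).a₁ = a₁) (hp₁ : 0 < p₁)
    (sel : (K b : ℕ) → Set (Site (F.P K) 0) → Site (F.P K) b)
    (hsel : ∀ (K b : ℕ) (Y : Set (Site (F.P K) 0)), sel K b Y ∈ anchors K b Y)
    (hγw : γ ≤ gammaθ 𝔠.b₀ p₁ (min a₁ (min (a₀ / 𝔠.B₃) (min (1 / (3 * (143 * ((((3 + 4 : ℕ) : ℝ)) ^ 2 / 4) ^ 2) * 𝔠.B₃))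
      (min (deltaSU (Fin 2) / ((((3 + 4) * F.L : ℕ) : ℝ) ^ 2 * 𝔠.B₃)) (1 / (8 * 10 ^ 14 * 𝔠.B₃))))))) :
    ∀ (K n : ℕ) (h : n ≤ K), ∀ j : ℕ, j + 1 < K - n → ∀ V : GaugeField (F.P n) 0 (Matrix.specialUnitaryGroup (Fin 2) ℂ), PlaqSmall (θBal F.L γ 𝔠.b₀ p₁ n) V →
        ∀ Y ∈ (AlphaInputsT3AC.dataOfV4chi p (canonPolymerRows fun K => (p K).toRows)).Loc K (K - n)
          ((AlphaInputsT3AC.dataOfV4chi p (canonPolymerRows fun K => (p K).toRows)).triv K (K - n)) (1 + j), ∀ c : PBond (F.P K) j,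
          ‖(fun K k b Y (U : GaugeField (F.P K) 0 (Matrix.specialUnitaryGroup (Fin 2) ℂ)) c =>
        if (l1 (rel (sel K b Y) c.src) : ℝ) * (2 * (𝔠.B₃ * θBal F.L γ 𝔠.b₀ p₁ (K - k)) * (((F.L : ℝ) ^ (k - b))⁻¹) ^ 2) ≤ 1 / 2 then
          (lieC (suGroupModel 2)).orthogonalProjectionOnto (vecE (suGroupModel 2).N (B27T (unitsField (toUField
            (Averaging.iter (fun i => BlockAveraging.blockAvg (P := F.P K) (j := i) ℰp) b U))) (sel K b Y) c))
        else 0) K (K - n) j Y ((p K).UkH (K - n) (Hist.triv (F.P K) (K - n)) (fieldShift (F.sitesPerDir_eq (m := F.m) (K := K) (j := K - n) (m' := F.m) (K' := n) (j' := 0) (by omega)) V)) c -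
            (fun K k b Y (U : GaugeField (F.P K) 0 (Matrix.specialUnitaryGroup (Fin 2) ℂ)) c =>
        if (l1 (rel (sel K b Y) c.src) : ℝ) * (2 * (𝔠.B₃ * θBal F.L γ 𝔠.b₀ p₁ (K - k)) * (((F.L : ℝ) ^ (k - b))⁻¹) ^ 2) ≤ 1 / 2 then
          (lieC (suGroupModel 2)).orthogonalProjectionOnto (vecE (suGroupModel 2).N (B27T (unitsField (toUField
            (Averaging.iter (fun i => BlockAveraging.blockAvg (P := F.P K) (j := i) ℰp) b U))) (sel K b Y) c))
        else 0) K (K - n) j Y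
              (fieldShift (F.sitesPerDir_eq (m := F.m) (K := K) (j := 0) (m' := F.m) (K' := K + 1) (j' := 1) (by omega)) ((BlockAveraging.blockAvg (P := F.P (K + 1)) (j := 0) ℰp).avg
                ((p (K + 1)).UkH (K + 1 - n) (Hist.triv (F.P (K + 1)) (K + 1 - n)) (fieldShift (F.sitesPerDir_eq (m := F.m) (K := K + 1) (j := K + 1 - n) (m' := F.m) (K' := n) (j' := 0) (by omega)) V)))) c‖ ≤
            256 * (F.L : ℝ) * (1 + canonLegDist F K j Y c) * (F.L : ℝ) ^ j *
              ⨆ e' : PBond (F.P K) 0, ‖(((p K).UkH (K - n) (Hist.triv (F.P K) (K - n)) (fieldShift (F.sitesPerDir_eq (m := F.m) (K := K) (j := K - n) (m' := F.m) (K' := n) (j' := 0) (by omega)) V) e' : Matrix.specialUnitaryGroup (Fin 2) ℂ) : Matrix (Fin 2) (Fin 2) ℂ) -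
                ((fieldShift (F.sitesPerDir_eq (m := F.m) (K := K) (j := 0) (m' := F.m) (K' := K + 1) (j' := 1) (by omega)) ((BlockAveraging.blockAvg (P := F.P (K + 1)) (j := 0) ℰp).avg
                ((p (K + 1)).UkH (K + 1 - n) (Hist.triv (F.P (K + 1)) (K + 1 - n)) (fieldShift (F.sitesPerDir_eq (m := F.m) (K := K + 1) (j := K + 1 - n) (m' := F.m) (K' := n) (j' := 0) (by omega)) V))) e' : Matrix.specialUnitaryGroup (Fin 2) ℂ) : Matrix (Fin 2) (Fin 2) ℂ)‖ :=
  lipNaturalSel_rows_of_le_gammaθ (fun K => (p K).toRows) ha₀ ha₁ hp hp₁ sel hsel hγw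

end Natural

end Summit.QuantumFields.YangMills.Theorems.GlobalSlackKernelLeg

end
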